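import Summits.QuantumFields.BalabanUV.T4Continuum.Support.ShellMeasureWilsonWords

/-!
# `T4Continuum.ShellMeasureExpLipschitz` — the second-order Lipschitz bound of the exponential in a complete normed
# algebra: `‖(exp a − 1 − a) − (exp b − 1 − b)‖ ≤ (eᵗ − 1)·‖a − b‖` for `‖a‖, ‖b‖ ≤ t`, non-commutative
# (cell `pub-balaban`, sub-cell `t4`, spine estimate NE7c (node U5b); lineage t4-ne7c-p1 = PROVER seat P1
# «shell-measure route», generation 25; helper of `ShellMeasureWilsonMoving`; ADDITIVE — imports
# `ShellMeasureWilsonWords` (p204908) only)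

HONEST FRAMING.  Pure [folklore] normed-algebra lemmas (termwise comparison of the exponential series with
`‖aᵐ − bᵐ‖ ≤ m·tᵐ⁻¹·‖a − b‖`); nothing of [Balaban 1983–89] is mentioned or asserted; (M1) NOT PRINTED untouched;
NE7c NOT proved; rung (B)+1 finite T⁴ only — NOT infinite volume, NOT mass gap, NOT Clay.  0 sorry, 0 citations.
USE: the moving-letter trace bound of `ShellMeasureWilsonMoving` (the Wilson part of (S-ii) at a live level, where
the minimiser's bond variables at contraction `c` and at `1` do not commute, so no exponential splitting is
available and the first-order term must be isolated by this bound).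
-/

noncomputable section

open NormedSpace Set

namespace Summit.QuantumFields.BalabanUV.T4Continuum.ShellMeasureExpLipschitz

open Literature.MathematicalPhysics.QuantumFieldTheory.Balaban1983to89

/-! ## The bound -/

section ExpLipschitz

variable {A : Type*} [NormedRing A] [NormedAlgebra ℂ A] [CompleteSpace A] [NormOneClass A]

omit [NormedAlgebra ℂ A] [CompleteSpace A] in
/-- non-commutative telescoping: `‖aᵐ − bᵐ‖ ≤ m·tᵐ⁻¹·‖a − b‖` for `‖a‖, ‖b‖ ≤ t`. [folklore] -/
theorem norm_pow_sub_pow_le {a b : A} {t : ℝ} (ha : ‖a‖ ≤ t) (hb : ‖b‖ ≤ t) :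
    ∀ m : ℕ, ‖a ^ m - b ^ m‖ ≤ m * t ^ (m - 1) * ‖a - b‖
  | 0 => by simp
  | m + 1 => by
    have ht : 0 ≤ t := (norm_nonneg _).trans ha
    have ih := norm_pow_sub_pow_le ha hb m
    have e : a ^ (m + 1) - b ^ (m + 1) = a * (a ^ m - b ^ m) + (a - b) * b ^ m := by
      rw [pow_succ', pow_succ']; noncomm_ring
    rw [e]
    have hbm : ‖b ^ m‖ ≤ t ^ m := (norm_pow_le b m).trans (pow_le_pow_left₀ (norm_nonneg _) hb m)
    calc ‖a * (a ^ m - b ^ m) + (a - b) * b ^ m‖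
        ≤ ‖a‖ * ‖a ^ m - b ^ m‖ + ‖a - b‖ * ‖b ^ m‖ :=
          (norm_add_le _ _).trans (add_le_add (norm_mul_le _ _) (norm_mul_le _ _))
      _ ≤ t * (m * t ^ (m - 1) * ‖a - b‖) + ‖a - b‖ * t ^ m := by gcongr
      _ = ((m : ℝ) * (t * t ^ (m - 1)) + t ^ m) * ‖a - b‖ := by ring
      _ ≤ ((m + 1 : ℕ) * t ^ (m + 1 - 1)) * ‖a - b‖ := by
          apply mul_le_mul_of_nonneg_right _ (norm_nonneg _)
          rcases Nat.eq_zero_or_pos m with hm | hm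
          · subst hm; simp
          · have : t * t ^ (m - 1) = t ^ m := by
              rw [← pow_succ']; congr 1; omega
            rw [this]; push_cast; simp; ring_nf; nlinarith [pow_nonneg ht m]

/-- **THE SECOND-ORDER LIPSCHITZ BOUND OF `exp`**: for `‖a‖, ‖b‖ ≤ t`,
`‖(exp a − 1 − a) − (exp b − 1 − b)‖ ≤ (eᵗ − 1)·‖a − b‖` (termwise: `Σ_{m≥2} m tᵐ⁻¹/m! = eᵗ − 1`). [folklore] -/
theorem norm_expTail_sub_expTail_le {a b : A} {t : ℝ} (ha : ‖a‖ ≤ t) (hb : ‖b‖ ≤ t) :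
    ‖(exp a - 1 - a) - (exp b - 1 - b)‖ ≤ (Real.exp t - 1) * ‖a - b‖ := by
  have ht : 0 ≤ t := (norm_nonneg _).trans ha
  -- the series of `exp x − 1 − x`
  have hser : ∀ x : A, HasSum (fun n : ℕ => (((n + 2).factorial : ℂ)⁻¹) • x ^ (n + 2)) (exp x - 1 - x) := by
    intro x
    have h1 : HasSum (fun n : ℕ => ((n.factorial : ℂ)⁻¹) • x ^ n) (exp x) := exp_series_hasSum_exp' (𝕂 := ℂ) x
    have h := (hasSum_nat_add_iff' 2).mpr h1
    have e : ∑ i ∈ Finset.range 2, ((i.factorial : ℂ)⁻¹) • x ^ i = 1 + x := by simp [Finset.sum_range_succ]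
    rw [e, ← sub_sub] at h
    exact h
  have hdiff : HasSum (fun n : ℕ => (((n + 2).factorial : ℂ)⁻¹) • (a ^ (n + 2) - b ^ (n + 2)))
      ((exp a - 1 - a) - (exp b - 1 - b)) := by
    simpa only [smul_sub] using (hser a).sub (hser b)
  -- the real majorant `Σ (n+2) t^{n+1} ‖a−b‖ / (n+2)! = (eᵗ − 1) ‖a − b‖`
  have hreal : HasSum (fun n : ℕ => t ^ (n + 1) / ((n + 1).factorial : ℝ)) (Real.exp t - 1) := by
    have h2 : HasSum (fun n : ℕ => t ^ n / (n.factorial : ℝ)) (Real.exp t) := by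
      rw [Real.exp_eq_exp_ℝ]; exact expSeries_div_hasSum_exp t
    have h := (hasSum_nat_add_iff' 1).mpr h2
    simpa using h
  have hmaj : HasSum (fun n : ℕ => t ^ (n + 1) / ((n + 1).factorial : ℝ) * ‖a - b‖) ((Real.exp t - 1) * ‖a - b‖) :=
    hreal.mul_right _
  refine hdiff.norm_le_of_bounded hmaj fun n => ?_
  rw [norm_smul, norm_inv, Complex.norm_natCast]
  have hp := norm_pow_sub_pow_le ha hb (n + 2)
  have hfac : ((n + 2).factorial : ℝ) = (n + 2 : ℕ) * ((n + 1).factorial : ℝ) := by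
    rw [Nat.factorial_succ]; push_cast; ring
  rw [hfac]
  have hf0 : (0 : ℝ) < ((n + 1).factorial : ℝ) := by exact_mod_cast Nat.factorial_pos _
  have hn0 : (0 : ℝ) < (n + 2 : ℕ) := by exact_mod_cast Nat.succ_pos _
  rw [show n + 2 - 1 = n + 1 from rfl] at hp
  calc ((n + 2 : ℕ) * ((n + 1).factorial : ℝ))⁻¹ * ‖a ^ (n + 2) - b ^ (n + 2)‖
      ≤ ((n + 2 : ℕ) * ((n + 1).factorial : ℝ))⁻¹ * ((n + 2 : ℕ) * t ^ (n + 1) * ‖a - b‖) := by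
        gcongr
    _ = t ^ (n + 1) / ((n + 1).factorial : ℝ) * ‖a - b‖ := by
        field_simp

/-- first-order consequence: `‖exp a − exp b‖ ≤ eᵗ·‖a − b‖` for `‖a‖, ‖b‖ ≤ t`. [folklore] -/
theorem norm_exp_sub_exp_le {a b : A} {t : ℝ} (ha : ‖a‖ ≤ t) (hb : ‖b‖ ≤ t) :
    ‖exp a - exp b‖ ≤ Real.exp t * ‖a - b‖ := by
  have h := norm_expTail_sub_expTail_le ha hb
  have e : exp a - exp b = (a - b) + ((exp a - 1 - a) - (exp b - 1 - b)) := by abel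
  rw [e]
  calc ‖(a - b) + ((exp a - 1 - a) - (exp b - 1 - b))‖ ≤ ‖a - b‖ + ‖(exp a - 1 - a) - (exp b - 1 - b)‖ :=
        norm_add_le _ _
    _ ≤ ‖a - b‖ + (Real.exp t - 1) * ‖a - b‖ := by gcongr
    _ = Real.exp t * ‖a - b‖ := by ring

end ExpLipschitz

end Summit.QuantumFields.BalabanUV.T4Continuum.ShellMeasureExpLipschitz
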